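import Summits.QuantumFields.BalabanUV.Beta.FP.PeriodisedBorderWardContact
import Summits.QuantumFields.BalabanUV.Beta.FP.TorusGaugeCovarianceCoarse
import Summits.QuantumFields.BalabanUV.Beta.FP.TorusCombRows

/-!
# `BalabanUV.Beta.FP.PeriodisedBorderWardContactInstance` — road «FP» for binder row D1, ROUTE T row **(T-ID)**, ORDER 1 AT THE TORUS CALL's TYPES:
# **THE MOVING-FRAME LETTER `c1` OF p308750 FOR THE ROOTED BORDER TABLE, WITH THE ULTRALOCAL GENERATOR JET `W₁` AND THE COARSE JET `D̄₁` EXPLICIT** —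
# `Q₁₁^{(κ,u)} · [D₂ | D₁] + Q₁₀ · W₁^{(κ,u)} = [D̄₁^{(κ,u)} | 0]` on the torus objects of `NestedStepLawTorusInstance` (fine box `fine N M′`, coarse box `M′`,
# field slots `(b.1, inl b.2)`, multiplier slots `(coarsePt p̄, inr m)`, residual parameters `Res (toSite r) N (fine N M′)` ∕ `Res (toSite r′) N M′`,
# generators `D₁ = tgrad↾`, `D₂ = tgradBlock↾`), where `W₁^{(κ,u)}` is supported on the insertion bond's row and reads the TIP `u + e_κ`
# (`−c·[block(tip) = t̄ | tip = s]`) and `D̄₁^{(κ,u)}((p̄,m), t̄) = −c · Q₁₀((p̄,m), (u,κ)) · [p̄ + e_m = t̄]`, `c = (N^{d+1}·stepScale d N j)⁻¹`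

HONEST DEPENDENCY (page 1, mandatory): continuum YM on T⁴ ⇐ BetaPertH ∧ nine spine estimates (0/9 proved); BetaPertH ⇐ (D1) ∧ (D4) ∧ CAP+tail;
G-an2-4 gates asym, D1 and NE2/3/4.  HONEST FRAMING (cell contract, verbatim): «discharging `BetaPertH` makes Bałaban's UV stability UNCONDITIONAL —
a real constructive-QFT result; it is NOT the continuum limit and NOT the Clay problem.»  ABSOLUTE RULE (cell charter, verbatim): «No internally-minted
statement may enter as a cited fact. Every hypothesis is either kernel-proved in this package or a verbatim quotation of a PUBLISHED theorem with page
reference. The manuscript(s) under audit are NOT citable for their own disputed steps — they are the thing under adjudication; programme-internal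
(2001/route/tribunal) claims are never citable.»  THIS MODULE is [folklore] finite-matrix bookkeeping over leaf-02's `PeriodisedBorderWardContact` (the
periodised fluctuation-leg law of an1's rooted table `vhSAt`, gan24-leaf-02's `tsum_vhSAt_mul_dz`) and gan24-leaf-05's `tgradBlock_eq_sum_tgrad_mul` ∕
`sum_tdelta_mul` ∕ `quo_zsmul_add_toSite'`; no `def` (the jets `W₁`, `D̄₁` are EXPLICIT `Matrix.of` terms in the statements), no `def … : Prop`, nothing cited,
0 sorry; 0 estimates; 0∕4 row-D1 binders; NOT (T-ID) complete (order 2, the `H`-letters `f*`, the `G`∕`Y` letters and WHICH table the literal's `Q₁₁` IS stay the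
dictionary's), NOT SDF, NOT D1, NOT BetaPertH, NOT continuum, NOT Clay.  «not in print; our bookkeeping».

WHY: OWNER d1-p3 g17 W-FP-17-10 (journal 2026-08-22 [D1P3-G17-INTENT8-A1]) — located finding F-d1leaf02g17-1 ADOPTED, the torus call RESHAPED to p308750's
frame-agnostic letters with `W₁ W₂ D̄₁ D̄₂` DISPLAYED, and «GO — THIS SHAPE» on the torus form of the order-1 moving letter; this file IS that letter for
single-bond insertions and, by linearity, for any finitely supported bond weight (§3).

CONTENT (`F := fine N M′`, `r ∈ box (d+1) N`, `[NeZero N]`, `[∀ μ, NeZero (M′ μ)]`; `c := (N^{d+1}·stepScale d N j)⁻¹`).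
* §1 the two blocks of `Q₁₁^{(κ,u)} · [D₂ | D₁]`: **`Q11_mul_D1_apply`** (residual block: `= tdelta F (u + e_κ) s · c · Q₁₀ a (u,κ)` — the TIP CONTACT, the far
  point being a root) and **`Q11_mul_D2_apply`** (block-constant block: `= c · Q₁₀ a (u,κ) · (tdelta M′ (quo N (u + e_κ)) t̄ − tdelta M′ (p̄ + e_m) t̄)`).
* §2 **`torus_c1_vhSAt`** — THE LETTER: `Q₁₁^{(κ,u)} * fromCols D₂ D₁ + Q₁₀ * W₁^{(κ,u)} = fromCols D̄₁^{(κ,u)} 0` with the two jets explicit (module header).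
* §3 **`torus_c1_vhSAt_weighted`** — the same for `Σ_b h b • Q₁₁^{b}`, `Σ_b h b • W₁^{b}`, `Σ_b h b • D̄₁^{b}` (any weight `h` on the torus bonds).
NOT HERE: `c2`; the identification of `D̄₁` with the coarse covariant-derivative jet in the dictionary's words; the (0.4)-sym table.
Provenance: D1 formalisation swarm LEAF PROVER 02, unit b2b-balaban-beta-d1-formalise-leaf-02 gen 17, 2026-08-22.  No existing file touched.
-/

noncomputable section

open scoped BigOperators

namespace Summit.QuantumFields.BalabanUV.Beta.FP.PeriodisedBorderWardContactInstance

open Finset Matrix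
open Literature.Probability.LatticeModels (Torus.proj)
open Literature.MathematicalPhysics.QuantumFieldTheory.Balaban1983to89
open Literature.MathematicalPhysics.QuantumFieldTheory.Balaban1983to89.Beta
open Literature.MathematicalPhysics.QuantumFieldTheory.LatticeForm (quo)
open B5Prop11Plancherel (fine)
open B6Lemma24Torus (pbox)
open AffineAveraging (Site box toSite unitVec)
open AveragingHessianKernelsRooted (vhSAt)
open OneStepResolventKernel (Fib)
open Summit.QuantumFields.BalabanUV.Beta.BorderedHessian (bhKStepAt stepScale)
open Summit.QuantumFields.BalabanUV.Beta.FP.KernelPeriodisationFib (Idx perF)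
open Summit.QuantumFields.BalabanUV.Beta.FP.KernelPeriodisationFibLoc (dper)
open Summit.QuantumFields.BalabanUV.Beta.FP.TorusGaugeCovariance (tdelta tgrad)
open Summit.QuantumFields.BalabanUV.Beta.FP.TorusGaugeCovariancePairing (sum_tdelta_mul)
open Summit.QuantumFields.BalabanUV.Beta.FP.TorusGaugeCovarianceCoarse (tgradBlock tgradBlock_eq_sum_tgrad_mul coarsePt coarsePt_coe proj_coarsePt
  tdelta_quo_wrapPt quo_zsmul_add_toSite')
open Summit.QuantumFields.BalabanUV.Beta.FP.TorusCombRows (Res ne_rootOf_iff_proj_ne)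
open Summit.QuantumFields.BalabanUV.Beta.GAN24.FineReadoutCauchyFrame (toSite_mem_range)
open Summit.QuantumFields.BalabanUV.Beta.FP.PeriodisedBorderWardContact (submatrix_vhSAt_mul_tgrad submatrix_vhSAt_mul_tgrad_of_not_root)

variable {d : ℕ} (M' : Fin (d + 1) → ℕ) [∀ μ, NeZero (M' μ)] {N : ℕ} [NeZero N] {r r' : Fin (d + 1) → ℕ}

omit [∀ μ, NeZero (M' μ)] [NeZero N] in
/-- the period shape of the fine box over the coarse box (definitional). -/
theorem fine_eq (i : Fin (d + 1)) : fine N M' i = N * M' i := rfl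

/-! ## §1 The two blocks of `Q₁₁^{(κ,u)} · [D₂ | D₁]` -/

/-- [folklore] **RESIDUAL BLOCK — THE TIP CONTACT**: `(Q₁₁^{(κ,u)} · D₁)((p̄,m), s) = tdelta F (u + e_κ) s · c · Q₁₀((p̄,m), (u,κ))` (`s` a residual parameter, i.e. a
non-root box point; the far contact point `N•p̄ + ρ + N•e_m` is a root). -/
theorem Q11_mul_D1_apply (hr : r ∈ box (d + 1) N) (j : ℕ) (κ : Fin (d + 1)) (u : ↥(pbox (fine N M')))
    {Q₁₀ Q₁₁ : Matrix (↥(pbox M') × Fin (d + 1)) (↥(pbox (fine N M')) × Fin (d + 1)) ℝ}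
    {D₁ : Matrix (↥(pbox (fine N M')) × Fin (d + 1)) (Res (toSite r) N (fine N M')) ℝ}
    (hQ₁₀ : Q₁₀ = (perF (fine N M') (bhKStepAt d (toSite r) N j)).submatrix
        (fun a : ↥(pbox M') × Fin (d + 1) => ((coarsePt M' N a.1, Sum.inr a.2) : Idx (fine N M') (Fib d)))
        (fun b : ↥(pbox (fine N M')) × Fin (d + 1) => ((b.1, Sum.inl b.2) : Idx (fine N M') (Fib d))))
    (hQ₁₁ : Q₁₁ = (perF (fine N M') (dper (fine N M') (vhSAt (toSite r) d N rfl κ (u : Site (d + 1))))).submatrix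
        (fun a : ↥(pbox M') × Fin (d + 1) => ((coarsePt M' N a.1, Sum.inr a.2) : Idx (fine N M') (Fib d)))
        (fun b : ↥(pbox (fine N M')) × Fin (d + 1) => ((b.1, Sum.inl b.2) : Idx (fine N M') (Fib d))))
    (hD₁ : D₁ = (tgrad (fine N M')).submatrix (fun b : ↥(pbox (fine N M')) × Fin (d + 1) => ((b.1, Sum.inl b.2) : Idx (fine N M') (Fib d)))
        (Subtype.val : Res (toSite r) N (fine N M') → ↥(pbox (fine N M'))))
    (a : ↥(pbox M') × Fin (d + 1)) (s : Res (toSite r) N (fine N M')) :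
    (Q₁₁ * D₁) a s = tdelta (fine N M') ((u : Site (d + 1)) + unitVec κ) s.1 * ((((N : ℝ) ^ (d + 1) * stepScale d N j)⁻¹) * Q₁₀ a (u, κ)) := by
  have hN : 0 < N := Nat.pos_of_ne_zero (NeZero.ne N)
  subst hQ₁₀ hQ₁₁ hD₁
  exact submatrix_vhSAt_mul_tgrad_of_not_root (M := fine N M') (M' := M') (fun i => rfl) hr j
    (fun a : ↥(pbox M') × Fin (d + 1) => ((coarsePt M' N a.1 : ↥(pbox (fine N M'))) : Site (d + 1))) (fun a => (coarsePt M' N a.1).2)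
    (fun a => a.2) Subtype.val (fun s : Res (toSite r) N (fine N M') => (ne_rootOf_iff_proj_ne hN (toSite_mem_range hr) s.site).1 s.not_root) κ u a s

/-- [folklore] **BLOCK-CONSTANT BLOCK**: `(Q₁₁^{(κ,u)} · D₂)((p̄,m), t̄) = c · Q₁₀((p̄,m), (u,κ)) · (tdelta M′ (quo N (u + e_κ)) t̄ − tdelta M′ (p̄ + e_m) t̄)` — the block of the tip
minus the block of the far endpoint of the coarse bond `(m, p̄)` (`tgradBlock_eq_sum_tgrad_mul`, `sum_tdelta_mul`, `quo_zsmul_add_toSite'`). -/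
theorem Q11_mul_D2_apply (hr : r ∈ box (d + 1) N) (j : ℕ) (κ : Fin (d + 1)) (u : ↥(pbox (fine N M')))
    {Q₁₀ Q₁₁ : Matrix (↥(pbox M') × Fin (d + 1)) (↥(pbox (fine N M')) × Fin (d + 1)) ℝ}
    {D₂ : Matrix (↥(pbox (fine N M')) × Fin (d + 1)) (Res (toSite r') N M') ℝ}
    (hQ₁₀ : Q₁₀ = (perF (fine N M') (bhKStepAt d (toSite r) N j)).submatrix
        (fun a : ↥(pbox M') × Fin (d + 1) => ((coarsePt M' N a.1, Sum.inr a.2) : Idx (fine N M') (Fib d)))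
        (fun b : ↥(pbox (fine N M')) × Fin (d + 1) => ((b.1, Sum.inl b.2) : Idx (fine N M') (Fib d))))
    (hQ₁₁ : Q₁₁ = (perF (fine N M') (dper (fine N M') (vhSAt (toSite r) d N rfl κ (u : Site (d + 1))))).submatrix
        (fun a : ↥(pbox M') × Fin (d + 1) => ((coarsePt M' N a.1, Sum.inr a.2) : Idx (fine N M') (Fib d)))
        (fun b : ↥(pbox (fine N M')) × Fin (d + 1) => ((b.1, Sum.inl b.2) : Idx (fine N M') (Fib d))))
    (hD₂ : D₂ = (tgradBlock M' N).submatrix (fun b : ↥(pbox (fine N M')) × Fin (d + 1) => ((b.1, Sum.inl b.2) : Idx (fine N M') (Fib d)))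
        (Subtype.val : Res (toSite r') N M' → ↥(pbox M')))
    (a : ↥(pbox M') × Fin (d + 1)) (t : Res (toSite r') N M') :
    (Q₁₁ * D₂) a t
      = ((((N : ℝ) ^ (d + 1) * stepScale d N j)⁻¹) * Q₁₀ a (u, κ))
        * (tdelta M' (quo N ((u : Site (d + 1)) + unitVec κ)) t.1 - tdelta M' ((a.1 : Site (d + 1)) + unitVec a.2) t.1) := by
  subst hQ₁₀ hQ₁₁ hD₂
  -- expand the block column over the `tgrad` columns and exchange the finite sums
  set Q11 := (perF (fine N M') (dper (fine N M') (vhSAt (toSite r) d N rfl κ (u : Site (d + 1))))).submatrix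
          (fun a : ↥(pbox M') × Fin (d + 1) => ((coarsePt M' N a.1, Sum.inr a.2) : Idx (fine N M') (Fib d)))
          (fun b : ↥(pbox (fine N M')) × Fin (d + 1) => ((b.1, Sum.inl b.2) : Idx (fine N M') (Fib d))) with hQ11
  have hx : (Q11 * (tgradBlock M' N).submatrix (fun b : ↥(pbox (fine N M')) × Fin (d + 1) => ((b.1, Sum.inl b.2) : Idx (fine N M') (Fib d)))
        (Subtype.val : Res (toSite r') N M' → ↥(pbox M'))) a t
      = ∑ s : ↥(pbox (fine N M')), (Q11 * (tgrad (fine N M')).submatrix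
            (fun b : ↥(pbox (fine N M')) × Fin (d + 1) => ((b.1, Sum.inl b.2) : Idx (fine N M') (Fib d))) id) a s
          * tdelta M' (quo N (s : Site (d + 1))) t.1 := by
    simp only [Matrix.mul_apply, Matrix.submatrix_apply, id_eq, tgradBlock_eq_sum_tgrad_mul, Finset.mul_sum, Finset.sum_mul, mul_assoc]
    exact Finset.sum_comm
  refine hx.trans ?_
  have hcol : ∀ s : ↥(pbox (fine N M')), (Q11 * (tgrad (fine N M')).submatrix
        (fun b : ↥(pbox (fine N M')) × Fin (d + 1) => ((b.1, Sum.inl b.2) : Idx (fine N M') (Fib d))) id) a s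
      = (tdelta (fine N M') ((u : Site (d + 1)) + unitVec κ) s - tdelta (fine N M') ((coarsePt M' N a.1 : Site (d + 1)) + toSite r + (N : ℤ) • unitVec a.2) s)
        * ((((N : ℝ) ^ (d + 1) * stepScale d N j)⁻¹)
          * (perF (fine N M') (bhKStepAt d (toSite r) N j)).submatrix
              (fun a : ↥(pbox M') × Fin (d + 1) => ((coarsePt M' N a.1, Sum.inr a.2) : Idx (fine N M') (Fib d)))
              (fun b : ↥(pbox (fine N M')) × Fin (d + 1) => ((b.1, Sum.inl b.2) : Idx (fine N M') (Fib d))) a (u, κ)) := fun s =>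
    submatrix_vhSAt_mul_tgrad (M := fine N M') (M' := M') (fun i => rfl) hr j
      (fun a : ↥(pbox M') × Fin (d + 1) => ((coarsePt M' N a.1 : ↥(pbox (fine N M'))) : Site (d + 1))) (fun a => (coarsePt M' N a.1).2)
      (fun a => a.2) id κ u a s
  simp only [hcol]
  set cQ : ℝ := (((N : ℝ) ^ (d + 1) * stepScale d N j)⁻¹)
          * (perF (fine N M') (bhKStepAt d (toSite r) N j)).submatrix
              (fun a : ↥(pbox M') × Fin (d + 1) => ((coarsePt M' N a.1, Sum.inr a.2) : Idx (fine N M') (Fib d)))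
              (fun b : ↥(pbox (fine N M')) × Fin (d + 1) => ((b.1, Sum.inl b.2) : Idx (fine N M') (Fib d))) a (u, κ) with hcQ
  have hre : ∀ s' : ↥(pbox (fine N M')),
      (tdelta (fine N M') ((u : Site (d + 1)) + unitVec κ) s' - tdelta (fine N M') ((coarsePt M' N a.1 : Site (d + 1)) + toSite r + (N : ℤ) • unitVec a.2) s')
          * cQ * tdelta M' (quo N (s' : Site (d + 1))) t.1
        = cQ * (tdelta (fine N M') ((u : Site (d + 1)) + unitVec κ) s' * tdelta M' (quo N (s' : Site (d + 1))) t.1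
          - tdelta (fine N M') ((coarsePt M' N a.1 : Site (d + 1)) + toSite r + (N : ℤ) • unitVec a.2) s' * tdelta M' (quo N (s' : Site (d + 1))) t.1) :=
    fun s' => by ring
  rw [Finset.sum_congr rfl fun s' _ => hre s', ← Finset.mul_sum, Finset.sum_sub_distrib, sum_tdelta_mul, sum_tdelta_mul, tdelta_quo_wrapPt,
    tdelta_quo_wrapPt, coarsePt_coe,
    show (N : ℤ) • (a.1 : Site (d + 1)) + toSite r + (N : ℤ) • unitVec a.2 = (N : ℤ) • ((a.1 : Site (d + 1)) + unitVec a.2) + toSite r by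
      rw [smul_add]; abel,
    quo_zsmul_add_toSite' hr]

/-! ## §2 The moving-frame letter `c1` with the two jets explicit -/

/-- [folklore] reading a product against a one-row matrix: `(Y * of (fun b e => if b = b₀ then w e else 0)) a e = Y a b₀ * w e`. -/
theorem mul_oneRow_apply {m n k : Type*} [Fintype n] [DecidableEq n] (Y : Matrix m n ℝ) (b₀ : n) (w : k → ℝ) (a : m) (e : k) :
    (Y * Matrix.of fun (b : n) (e : k) => if b = b₀ then w e else 0) a e = Y a b₀ * w e := by
  rw [Matrix.mul_apply]
  simp only [Matrix.of_apply, mul_ite, mul_zero, Finset.sum_ite_eq', Finset.mem_univ, if_true]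

/-- [folklore] **`torus_c1_vhSAt` — THE ORDER-1 MOVING-FRAME LETTER OF p308750 AT THE TORUS CALL's TYPES, ROOTED BORDER TABLE, SINGLE-BOND INSERTION `(κ, u)`**:
`Q₁₁ * fromCols D₂ D₁ + Q₁₀ * W₁ = fromCols D̄₁ 0` with the ULTRALOCAL generator jet
`W₁ := of (fun b e => [b = (u,κ)] · (−c) · (Sum.elim (fun t̄ => tdelta M′ (quo N (u + e_κ)) t̄) (fun s => tdelta F (u + e_κ) s) e))` (row `(u,κ)` only; it reads the TIP)
and the coarse jet `D̄₁ := of (fun (p̄,m) t̄ => −c · Q₁₀ (p̄,m) (u,κ) · tdelta M′ (p̄ + e_m) t̄)`, `c = (N^{d+1}·stepScale d N j)⁻¹`; the torus objects by their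
defining equations (instantiate with `rfl`). -/
theorem torus_c1_vhSAt (hr : r ∈ box (d + 1) N) (j : ℕ) (κ : Fin (d + 1)) (u : ↥(pbox (fine N M')))
    {Q₁₀ Q₁₁ : Matrix (↥(pbox M') × Fin (d + 1)) (↥(pbox (fine N M')) × Fin (d + 1)) ℝ}
    {D₁ : Matrix (↥(pbox (fine N M')) × Fin (d + 1)) (Res (toSite r) N (fine N M')) ℝ}
    {D₂ : Matrix (↥(pbox (fine N M')) × Fin (d + 1)) (Res (toSite r') N M') ℝ}
    (hQ₁₀ : Q₁₀ = (perF (fine N M') (bhKStepAt d (toSite r) N j)).submatrix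
        (fun a : ↥(pbox M') × Fin (d + 1) => ((coarsePt M' N a.1, Sum.inr a.2) : Idx (fine N M') (Fib d)))
        (fun b : ↥(pbox (fine N M')) × Fin (d + 1) => ((b.1, Sum.inl b.2) : Idx (fine N M') (Fib d))))
    (hQ₁₁ : Q₁₁ = (perF (fine N M') (dper (fine N M') (vhSAt (toSite r) d N rfl κ (u : Site (d + 1))))).submatrix
        (fun a : ↥(pbox M') × Fin (d + 1) => ((coarsePt M' N a.1, Sum.inr a.2) : Idx (fine N M') (Fib d)))
        (fun b : ↥(pbox (fine N M')) × Fin (d + 1) => ((b.1, Sum.inl b.2) : Idx (fine N M') (Fib d))))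
    (hD₁ : D₁ = (tgrad (fine N M')).submatrix (fun b : ↥(pbox (fine N M')) × Fin (d + 1) => ((b.1, Sum.inl b.2) : Idx (fine N M') (Fib d)))
        (Subtype.val : Res (toSite r) N (fine N M') → ↥(pbox (fine N M'))))
    (hD₂ : D₂ = (tgradBlock M' N).submatrix (fun b : ↥(pbox (fine N M')) × Fin (d + 1) => ((b.1, Sum.inl b.2) : Idx (fine N M') (Fib d)))
        (Subtype.val : Res (toSite r') N M' → ↥(pbox M'))) :
    Q₁₁ * fromCols D₂ D₁
        + Q₁₀ * Matrix.of (fun (b : ↥(pbox (fine N M')) × Fin (d + 1)) (e : Res (toSite r') N M' ⊕ Res (toSite r) N (fine N M')) =>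
            if b = (u, κ) then
              -((((N : ℝ) ^ (d + 1) * stepScale d N j)⁻¹)
                * Sum.elim (fun t : Res (toSite r') N M' => tdelta M' (quo N ((u : Site (d + 1)) + unitVec κ)) t.1)
                    (fun s : Res (toSite r) N (fine N M') => tdelta (fine N M') ((u : Site (d + 1)) + unitVec κ) s.1) e)
            else 0)
      = fromCols
          (Matrix.of fun (a : ↥(pbox M') × Fin (d + 1)) (t : Res (toSite r') N M') =>
            -((((N : ℝ) ^ (d + 1) * stepScale d N j)⁻¹) * Q₁₀ a (u, κ) * tdelta M' ((a.1 : Site (d + 1)) + unitVec a.2) t.1))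
          (0 : Matrix (↥(pbox M') × Fin (d + 1)) (Res (toSite r) N (fine N M')) ℝ) := by
  ext a e
  rw [Matrix.add_apply, mul_oneRow_apply, Matrix.mul_fromCols]
  rcases e with t | s
  · rw [fromCols_apply_inl, fromCols_apply_inl, Matrix.of_apply, Q11_mul_D2_apply M' hr j κ u hQ₁₀ hQ₁₁ hD₂ a t]
    simp only [Sum.elim_inl]
    ring
  · rw [fromCols_apply_inr, fromCols_apply_inr, Matrix.zero_apply, Q11_mul_D1_apply M' hr j κ u hQ₁₀ hQ₁₁ hD₁ a s]
    simp only [Sum.elim_inr]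
    ring

/-! ## §3 Weighted insertions (any bond weight on the torus), by linearity -/

/-- [folklore] a weighted family of letters `A i * X + Y * B i = [C i | 0]` sums to the letter of the weighted objects. -/
theorem weighted_letter {ι m n k₁ k₂ : Type*} [Fintype ι] [Fintype n] (h : ι → ℝ) (A : ι → Matrix m n ℝ) (X : Matrix n (k₁ ⊕ k₂) ℝ)
    (Y : Matrix m n ℝ) (B : ι → Matrix n (k₁ ⊕ k₂) ℝ) (C : ι → Matrix m k₁ ℝ) (hb : ∀ i, A i * X + Y * B i = fromCols (C i) 0) :
    (∑ i, h i • A i) * X + Y * (∑ i, h i • B i) = fromCols (∑ i, h i • C i) (0 : Matrix m k₂ ℝ) := by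
  rw [Matrix.sum_mul, Matrix.mul_sum, ← Finset.sum_add_distrib]
  have hi : ∀ i, h i • A i * X + Y * (h i • B i) = h i • fromCols (C i) (0 : Matrix m k₂ ℝ) := fun i => by
    rw [Matrix.smul_mul, Matrix.mul_smul, ← smul_add, hb i]
  simp only [hi]
  ext a e
  rcases e with t | s
  · simp only [Matrix.sum_apply, Matrix.smul_apply, fromCols_apply_inl]
  · simp only [Matrix.sum_apply, Matrix.smul_apply, fromCols_apply_inr, Matrix.zero_apply, smul_zero, Finset.sum_const_zero]

/-- [folklore] **`torus_c1_vhSAt_weighted` — THE ORDER-1 MOVING-FRAME LETTER FOR ANY BOND WEIGHT `h` ON THE TORUS**: with `Q₁₁(h) := Σ_b h b • Q₁₁^{b}`,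
`W₁(h) := Σ_b h b • W₁^{b}`, `D̄₁(h) := Σ_b h b • D̄₁^{b}` (the single-bond objects of `torus_c1_vhSAt`, `b = (u, κ)`), `Q₁₁(h) * [D₂|D₁] + Q₁₀ * W₁(h) = [D̄₁(h) | 0]`. -/
theorem torus_c1_vhSAt_weighted (hr : r ∈ box (d + 1) N) (j : ℕ) (h : ↥(pbox (fine N M')) × Fin (d + 1) → ℝ)
    {Q₁₀ : Matrix (↥(pbox M') × Fin (d + 1)) (↥(pbox (fine N M')) × Fin (d + 1)) ℝ}
    {D₁ : Matrix (↥(pbox (fine N M')) × Fin (d + 1)) (Res (toSite r) N (fine N M')) ℝ}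
    {D₂ : Matrix (↥(pbox (fine N M')) × Fin (d + 1)) (Res (toSite r') N M') ℝ}
    (hQ₁₀ : Q₁₀ = (perF (fine N M') (bhKStepAt d (toSite r) N j)).submatrix
        (fun a : ↥(pbox M') × Fin (d + 1) => ((coarsePt M' N a.1, Sum.inr a.2) : Idx (fine N M') (Fib d)))
        (fun b : ↥(pbox (fine N M')) × Fin (d + 1) => ((b.1, Sum.inl b.2) : Idx (fine N M') (Fib d))))
    (hD₁ : D₁ = (tgrad (fine N M')).submatrix (fun b : ↥(pbox (fine N M')) × Fin (d + 1) => ((b.1, Sum.inl b.2) : Idx (fine N M') (Fib d)))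
        (Subtype.val : Res (toSite r) N (fine N M') → ↥(pbox (fine N M'))))
    (hD₂ : D₂ = (tgradBlock M' N).submatrix (fun b : ↥(pbox (fine N M')) × Fin (d + 1) => ((b.1, Sum.inl b.2) : Idx (fine N M') (Fib d)))
        (Subtype.val : Res (toSite r') N M' → ↥(pbox M'))) :
    (∑ b : ↥(pbox (fine N M')) × Fin (d + 1), h b •
          (perF (fine N M') (dper (fine N M') (vhSAt (toSite r) d N rfl b.2 (b.1 : Site (d + 1))))).submatrix
            (fun a : ↥(pbox M') × Fin (d + 1) => ((coarsePt M' N a.1, Sum.inr a.2) : Idx (fine N M') (Fib d)))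
            (fun b : ↥(pbox (fine N M')) × Fin (d + 1) => ((b.1, Sum.inl b.2) : Idx (fine N M') (Fib d))))
        * fromCols D₂ D₁
      + Q₁₀ * ∑ b : ↥(pbox (fine N M')) × Fin (d + 1), h b •
          Matrix.of (fun (b' : ↥(pbox (fine N M')) × Fin (d + 1)) (e : Res (toSite r') N M' ⊕ Res (toSite r) N (fine N M')) =>
            if b' = b then
              -((((N : ℝ) ^ (d + 1) * stepScale d N j)⁻¹)
                * Sum.elim (fun t : Res (toSite r') N M' => tdelta M' (quo N ((b.1 : Site (d + 1)) + unitVec b.2)) t.1)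
                    (fun s : Res (toSite r) N (fine N M') => tdelta (fine N M') ((b.1 : Site (d + 1)) + unitVec b.2) s.1) e)
            else 0)
      = fromCols
          (∑ b : ↥(pbox (fine N M')) × Fin (d + 1), h b •
            Matrix.of fun (a : ↥(pbox M') × Fin (d + 1)) (t : Res (toSite r') N M') =>
              -((((N : ℝ) ^ (d + 1) * stepScale d N j)⁻¹) * Q₁₀ a b * tdelta M' ((a.1 : Site (d + 1)) + unitVec a.2) t.1))
          (0 : Matrix (↥(pbox M') × Fin (d + 1)) (Res (toSite r) N (fine N M')) ℝ) := by
  refine weighted_letter h _ _ _ _ _ fun b => ?_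
  obtain ⟨u, κ⟩ := b
  exact torus_c1_vhSAt M' hr j κ u hQ₁₀ rfl hD₁ hD₂

end Summit.QuantumFields.BalabanUV.Beta.FP.PeriodisedBorderWardContactInstance

end
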